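import Summits.Ventures.Crystal3D.Theorems.StickyWulffConstantCoaxialWallLawTailResidueDefs
import Summits.Ventures.Crystal3D.Theorems.StickyWulffConstantCoaxialWallLawEndRowOuterShell
import HarnessLib

/-!
# DECORATION: removing loose dust and recording it as degree decorations does not decrease the summand (pool side of T4)
# (crux `CoaxialWallLaw`, stmt-Ventures-19481, line `WallLedgerF`; census-free)

HONEST FRAMING. Venture `Summits/Ventures/Crystal3D` (cell `crystal3d-full`), helper `--supports` the crux `CoaxialWallLaw`
(stmt-Ventures-19481, `route-Ventures-StickyWulffConstant`), REGISTERED line `WallLedgerF` (planner cf-p1, (xcv)(1): T4 pieces first).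
Census-free; F-C1 not moved.  The (A2) LOOSE FILLERS of `…TailResidueDefs(2)` enter the certificate only through DECORATIONS: the
hosts' degrees `+1` and a credited deficiency in the pools they touch.  This file proves the pool-side bookkeeping exactly:

Let `X₀ ⊆ X`, `X` `1`-separated, `z ∈ X₀`, and write `D = X ∖ X₀` (the dust).  Define the TRUE decorations
`dustDeg X X₀ y = #{x ∈ D : dist y x = 1}` and `dustCredit X X₀ b = Σ_{x ∈ D, dist b x ≤ 1, deg_X x ≤ 11} (12 − deg_X x)`.  Then
* `degree_eq_degDec` — `deg_X y = degDec X₀ (dustDeg X X₀) y` for `y ∈ X₀` … (exactly);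
* `pooledDefFlatDec_le_pooledDef` — for `b ∈ X₀` with two payers in `X`:
  `pooledDefFlatDec X₀ (dustDeg …) (dustCredit …) b ≤ pooledDef X b`;
* **`localSummandA_le_localSummandFlatDec_of_dust`** — if every (A)-end pair `(b, q)` of `X` with `b` within `1` of `z` is a FLAT
  end pair of `X₀` (the dust is at no reading / target / predecessor position — the hypothesis `hD`, to be discharged by the frame
  lemma of T4), then `localSummandA v S₁ S₂ X z ≤ Σ_b endMultFlat X₀ b / pooledDefFlatDec X₀ (dustDeg) (dustCredit) b` — literally
  `TailResidue.localSummandFlatDec v S₁ S₂ X₀ (dustDeg X X₀) (dustCredit X X₀) z` of `…TailResidueDefs2` (stated unfolded here).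
So type soundness for loose fillers reduces to (i) `hD` (generalized frame lemma) and (ii) `fillerCredit ≤ dustCredit` termwise
(each dust ball touching `b` has `deg ≤ #hosts + #other dust`), both geometric.
WHAT THIS IS NOT: not (i) or (ii); F-C1 not moved.
-/

noncomputable section

namespace Summit.Ventures.Crystal3D.Theorems

open Summit.Ventures.Crystal3D Finset TailResidue
open scoped InnerProductSpace

section Dust

variable {X X₀ : Finset (EuclideanSpace ℝ (Fin 3))} {z : EuclideanSpace ℝ (Fin 3)}

open scoped Classical in
/-- The TRUE degree decoration: the number of dust balls (`X ∖ X₀`) touching `y`. -/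
def dustDeg (X X₀ : Finset (EuclideanSpace ℝ (Fin 3))) (y : EuclideanSpace ℝ (Fin 3)) : ℕ :=
  ((X \ X₀).filter fun x => dist y x = 1).card

open scoped Classical in
/-- The TRUE dust credit of the pool of `b`: the deficiencies of the deficient dust balls within `1` of `b`. -/
def dustCredit (X X₀ : Finset (EuclideanSpace ℝ (Fin 3))) (b : EuclideanSpace ℝ (Fin 3)) : ℝ :=
  ∑ x ∈ (X \ X₀).filter (fun x => dist b x ≤ 1 ∧ (X.filter fun q => dist x q = 1).card ≤ 11),
    ((12 : ℝ) - ((X.filter fun q => dist x q = 1).card : ℝ))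

variable (hsub : X₀ ⊆ X)
include hsub

open scoped Classical in
/-- **Degrees split**: `deg_X y = deg_{X₀} y + dustDeg y`. -/
theorem degree_eq_degDec (y : EuclideanSpace ℝ (Fin 3)) :
    (X.filter fun q => dist y q = 1).card = degDec X₀ (dustDeg X X₀) y := by
  unfold degDec dustDeg
  rw [← card_union_of_disjoint]
  · congr 1
    ext q
    simp only [mem_filter, mem_union, mem_sdiff]
    constructor
    · rintro ⟨hq, hd⟩
      by_cases h : q ∈ X₀
      · exact Or.inl ⟨h, hd⟩
      · exact Or.inr ⟨⟨hq, h⟩, hd⟩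
    · rintro (⟨hq, hd⟩ | ⟨⟨hq, -⟩, hd⟩)
      · exact ⟨hsub hq, hd⟩
      · exact ⟨hq, hd⟩
  · rw [disjoint_left]
    intro q hq hq'
    exact (mem_sdiff.1 (mem_filter.1 hq').1).2 (mem_filter.1 hq).1

omit hsub in
open scoped Classical in
/-- The dust credit is non-negative. -/
theorem dustCredit_nonneg (b : EuclideanSpace ℝ (Fin 3)) : 0 ≤ dustCredit X X₀ b := by
  unfold dustCredit
  refine sum_nonneg fun x hx => ?_
  have : ((X.filter fun q => dist x q = 1).card : ℝ) ≤ 11 := by exact_mod_cast (mem_filter.1 hx).2.2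
  linarith

open scoped Classical in
/-- **Two payers transfer to the decorated clause.** -/
theorem hasTwoPayersDec_of_hasTwoPayers {b : EuclideanSpace ℝ (Fin 3)} (h : HasTwoPayers X b) :
    HasTwoPayersDec X₀ (dustDeg X X₀) b := by
  unfold HasTwoPayersDec
  unfold HasTwoPayers at h
  rcases h with hdeg | ⟨z₁, hz₁, z₂, hz₂, hne, hd₁, hd₂, hc₁, hc₂⟩
  · left; rwa [← degree_eq_degDec hsub]
  · right
    -- each of `z₁, z₂` is a deficient exact neighbour or a dust ball touching `b`
    set A := X₀.filter (fun y => dist b y = 1 ∧ degDec X₀ (dustDeg X X₀) y ≤ 11) with hA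
    set B := (X \ X₀).filter (fun x => dist b x = 1) with hB
    have hB' : dustDeg X X₀ b = B.card := rfl
    have hmem : ∀ w ∈ X, dist b w = 1 → (X.filter fun q => dist w q = 1).card ≤ 11 → w ∈ A ∪ B := by
      intro w hw hdw hcw
      by_cases h0 : w ∈ X₀
      · exact mem_union_left _ (mem_filter.2 ⟨h0, hdw, by rwa [← degree_eq_degDec hsub]⟩)
      · exact mem_union_right _ (mem_filter.2 ⟨mem_sdiff.2 ⟨hw, h0⟩, hdw⟩)
    have h2 : 2 ≤ (A ∪ B).card := by
      have hsub2 : ({z₁, z₂} : Finset _) ⊆ A ∪ B := by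
        intro w hw
        rcases mem_insert.1 hw with rfl | hw
        · exact hmem _ hz₁ hd₁ hc₁
        · rw [mem_singleton] at hw; rw [hw]; exact hmem _ hz₂ hd₂ hc₂
      calc 2 = ({z₁, z₂} : Finset _).card := by rw [card_pair hne]
        _ ≤ (A ∪ B).card := card_le_card hsub2
    rw [hB']
    exact le_trans h2 (card_union_le A B)

open scoped Classical in
/-- **Pools**: for `b` with two payers in `X`, the decorated flat pool of `X₀` is at most the true pool of `X`. -/
theorem pooledDefFlatDec_le_pooledDef {b : EuclideanSpace ℝ (Fin 3)} (hpay : HasTwoPayers X b) :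
    pooledDefFlatDec X₀ (dustDeg X X₀) (dustCredit X X₀) b ≤ pooledDef X b := by
  unfold pooledDefFlatDec pooledDef dustCredit
  rw [if_pos (hasTwoPayersDec_of_hasTwoPayers hsub hpay), add_zero]
  -- split the true pool into its exact part and its dust part
  set P := X.filter (fun y => dist b y ≤ 1 ∧ (X.filter fun q => dist y q = 1).card ≤ 11) with hP
  set P₀ := X₀.filter (fun y => dist b y ≤ 1 ∧ degDec X₀ (dustDeg X X₀) y ≤ 11) with hP₀
  set P₁ := (X \ X₀).filter (fun x => dist b x ≤ 1 ∧ (X.filter fun q => dist x q = 1).card ≤ 11) with hP₁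
  have hunion : P₀ ∪ P₁ ⊆ P := by
    intro y hy
    rcases mem_union.1 hy with h | h
    · obtain ⟨hy0, hd, hdeg⟩ := mem_filter.1 h
      exact mem_filter.2 ⟨hsub hy0, hd, by rwa [degree_eq_degDec hsub]⟩
    · obtain ⟨hy1, hd, hdeg⟩ := mem_filter.1 h
      exact mem_filter.2 ⟨(mem_sdiff.1 hy1).1, hd, hdeg⟩
  have hdisj : Disjoint P₀ P₁ := by
    rw [disjoint_left]
    intro y hy hy'
    exact (mem_sdiff.1 (mem_filter.1 hy').1).2 (mem_filter.1 hy).1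
  have hterm : ∀ y ∈ P₀, ((12 : ℝ) - (degDec X₀ (dustDeg X X₀) y : ℝ)) = (12 : ℝ) - ((X.filter fun q => dist y q = 1).card : ℝ) := by
    intro y _; rw [degree_eq_degDec hsub]
  calc (∑ y ∈ P₀, ((12 : ℝ) - (degDec X₀ (dustDeg X X₀) y : ℝ))) +
        ∑ x ∈ P₁, ((12 : ℝ) - ((X.filter fun q => dist x q = 1).card : ℝ))
      = ∑ y ∈ P₀ ∪ P₁, ((12 : ℝ) - ((X.filter fun q => dist y q = 1).card : ℝ)) := by
        rw [sum_union hdisj, sum_congr rfl hterm]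
    _ ≤ ∑ y ∈ P, ((12 : ℝ) - ((X.filter fun q => dist y q = 1).card : ℝ)) := by
        refine sum_le_sum_of_subset_of_nonneg hunion fun y hy _ => ?_
        have : ((X.filter fun q => dist y q = 1).card : ℝ) ≤ 11 := by exact_mod_cast (mem_filter.1 hy).2.2
        linarith

variable {v : WordVersion} {S₁ S₂ : PlateSystem} (hz : z ∈ X₀)
  (hD : ∀ b q : EuclideanSpace ℝ (Fin 3), dist z b ≤ 1 → IsEndPairA X v S₁ S₂ b q → IsEndPairFlat X₀ v S₁ S₂ b q)
include hD

omit hsub in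
open scoped Classical in
/-- **Multiplicities**: `endMultA X b ≤ endMultFlat X₀ b` for `b` within `1` of `z` (hypothesis `hD`). -/
theorem endMultA_le_endMultFlat_of_dust {b : EuclideanSpace ℝ (Fin 3)} (hzb : dist z b ≤ 1) :
    endMultA X v S₁ S₂ b ≤ endMultFlat X₀ v S₁ S₂ b := by
  unfold endMultA endMultFlat
  refine card_le_card fun q hq => ?_
  have h := hD b q hzb (mem_filter.1 hq).2
  exact mem_filter.2 ⟨h.1, h⟩

omit hsub in
open scoped Classical in
/-- A loaded ball within `1` of `z` is exact (it is the target of a flat end pair of `X₀`). -/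
theorem mem_of_loaded {b : EuclideanSpace ℝ (Fin 3)} (hzb : dist z b ≤ 1) (hpos : 0 < endMultA X v S₁ S₂ b) : b ∈ X₀ := by
  unfold endMultA at hpos
  obtain ⟨q, hq⟩ := card_pos.1 hpos
  exact (hD b q hzb (mem_filter.1 hq).2).2.1

include hz in
open scoped Classical in
/-- **DECORATION LEMMA.**  Removing the dust `X ∖ X₀` and recording it as the true decorations does not decrease the (A) summand
at `z`, provided every end pair near `z` survives as a flat end pair of `X₀`. -/
theorem localSummandA_le_localSummandFlatDec_of_dust :
    localSummandA v S₁ S₂ X z ≤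
      ∑ b ∈ X₀.filter (fun b => dist z b ≤ 1 ∧ 0 < endMultFlat X₀ v S₁ S₂ b),
        (endMultFlat X₀ v S₁ S₂ b : ℝ) / pooledDefFlatDec X₀ (dustDeg X X₀) (dustCredit X X₀) b := by
  have _ := hz
  unfold localSummandA
  have hp : ∀ b, 0 ≤ pooledDefFlatDec X₀ (dustDeg X X₀) (dustCredit X X₀) b := by
    intro b
    unfold pooledDefFlatDec
    refine add_nonneg (add_nonneg (sum_nonneg fun y hy => ?_) (dustCredit_nonneg b)) (by split_ifs <;> norm_num)
    have : (degDec X₀ (dustDeg X X₀) y : ℝ) ≤ 11 := by exact_mod_cast (mem_filter.1 hy).2.2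
    linarith
  have hpos_pool : ∀ b ∈ X₀, HasTwoPayers X b → 0 < pooledDefFlatDec X₀ (dustDeg X X₀) (dustCredit X X₀) b := by
    intro b hb hpay
    unfold pooledDefFlatDec
    rw [if_pos (hasTwoPayersDec_of_hasTwoPayers hsub hpay), add_zero]
    -- some payer: `b` itself deficient, or a deficient neighbour (exact or dust)
    rcases hpay with hdeg | ⟨z₁, hz₁, z₂, hz₂, hne, hd₁, hd₂, hc₁, hc₂⟩
    · refine add_pos_of_pos_of_nonneg ?_ (dustCredit_nonneg b)
      refine sum_pos' (fun y hy => ?_) ⟨b, mem_filter.2 ⟨hb, by simp, by rwa [← degree_eq_degDec hsub]⟩, ?_⟩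
      · have : (degDec X₀ (dustDeg X X₀) y : ℝ) ≤ 11 := by exact_mod_cast (mem_filter.1 hy).2.2
        linarith
      · have : (degDec X₀ (dustDeg X X₀) b : ℝ) ≤ 11 := by rw [← degree_eq_degDec hsub]; exact_mod_cast hdeg
        linarith
    · by_cases h0 : z₁ ∈ X₀
      · refine add_pos_of_pos_of_nonneg ?_ (dustCredit_nonneg b)
        refine sum_pos' (fun y hy => ?_) ⟨z₁, mem_filter.2 ⟨h0, by rw [hd₁], by rwa [← degree_eq_degDec hsub]⟩, ?_⟩
        · have : (degDec X₀ (dustDeg X X₀) y : ℝ) ≤ 11 := by exact_mod_cast (mem_filter.1 hy).2.2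
          linarith
        · have : (degDec X₀ (dustDeg X X₀) z₁ : ℝ) ≤ 11 := by rw [← degree_eq_degDec hsub]; exact_mod_cast hc₁
          linarith
      · refine add_pos_of_nonneg_of_pos (sum_nonneg fun y hy => ?_) ?_
        · have : (degDec X₀ (dustDeg X X₀) y : ℝ) ≤ 11 := by exact_mod_cast (mem_filter.1 hy).2.2
          linarith
        · unfold dustCredit
          refine sum_pos' (fun x hx => ?_) ⟨z₁, mem_filter.2 ⟨mem_sdiff.2 ⟨hz₁, h0⟩, by rw [hd₁], hc₁⟩, ?_⟩
          · have : ((X.filter fun q => dist x q = 1).card : ℝ) ≤ 11 := by exact_mod_cast (mem_filter.1 hx).2.2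
            linarith
          · have : ((X.filter fun q => dist z₁ q = 1).card : ℝ) ≤ 11 := by exact_mod_cast hc₁
            linarith
  calc ∑ b ∈ X.filter (fun b => dist z b ≤ 1 ∧ 0 < endMultA X v S₁ S₂ b), (endMultA X v S₁ S₂ b : ℝ) / pooledDef X b
      ≤ ∑ b ∈ X.filter (fun b => dist z b ≤ 1 ∧ 0 < endMultA X v S₁ S₂ b),
          (endMultFlat X₀ v S₁ S₂ b : ℝ) / pooledDefFlatDec X₀ (dustDeg X X₀) (dustCredit X X₀) b := by
        refine sum_le_sum fun b hb => ?_
        obtain ⟨hbX, hzb, hpos⟩ := mem_filter.1 hb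
        have hb0 : b ∈ X₀ := mem_of_loaded hD hzb hpos
        -- `b` has two payers (it is the target of an end pair of `X`)
        have hpay : HasTwoPayers X b := by
          unfold endMultA at hpos
          obtain ⟨q, hq⟩ := card_pos.1 hpos
          exact (mem_filter.1 hq).2.2.2.1
        have hpd : pooledDefFlatDec X₀ (dustDeg X X₀) (dustCredit X X₀) b ≤ pooledDef X b :=
          pooledDefFlatDec_le_pooledDef hsub hpay
        have hpd0 := hpos_pool b hb0 hpay
        calc (endMultA X v S₁ S₂ b : ℝ) / pooledDef X b
            ≤ (endMultA X v S₁ S₂ b : ℝ) / pooledDefFlatDec X₀ (dustDeg X X₀) (dustCredit X X₀) b :=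
              div_le_div_of_nonneg_left (Nat.cast_nonneg _) hpd0 hpd
          _ ≤ (endMultFlat X₀ v S₁ S₂ b : ℝ) / pooledDefFlatDec X₀ (dustDeg X X₀) (dustCredit X X₀) b :=
              div_le_div_of_nonneg_right (by exact_mod_cast endMultA_le_endMultFlat_of_dust hD hzb) (hp b)
    _ ≤ ∑ b ∈ X₀.filter (fun b => dist z b ≤ 1 ∧ 0 < endMultFlat X₀ v S₁ S₂ b),
          (endMultFlat X₀ v S₁ S₂ b : ℝ) / pooledDefFlatDec X₀ (dustDeg X X₀) (dustCredit X X₀) b := by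
        refine sum_le_sum_of_subset_of_nonneg (fun b hb => ?_) fun b _ _ => div_nonneg (Nat.cast_nonneg _) (hp b)
        obtain ⟨hbX, hzb, hpos⟩ := mem_filter.1 hb
        exact mem_filter.2 ⟨mem_of_loaded hD hzb hpos, hzb,
          lt_of_lt_of_le hpos (endMultA_le_endMultFlat_of_dust hD hzb)⟩

end Dust

end Summit.Ventures.Crystal3D.Theorems

end
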